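/-
Copyright: cell pub-balaban-gaps, seat ne8 (estimate NE7c), gen 12. Project licence.
-/
import Summits.QuantumFields.BalabanUV.T4Continuum.Spine.NE7b.CompactFibreCreationFloorSU2
import Summits.QuantumFields.BalabanUV.T4Continuum.Spine.NE7c.LiveFactorWindowVolume

/-!
# Road (δ) on the (n)-carrier's CREATION-STEP PRICE (`SU(2)` model): ne6's `creationPrice_SU2` and its LEDGER ROW read at a live window AND
# a live large-field radius — ONE price for the grid, `exp(i₀ − λ₀²·(λ∕2)δ′² + #bonds·(2 log η⁻¹ + log 16) + #bonds·2 log ν₀⁻¹)`, and the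
# ledger row STILL EVENTUALLY TRUE with `c ↦ λ₀²c`, `b ↦ b + 2 log ν₀⁻¹` (row NE7c; junction J-12, the capstone of J-9∕J-10∕J-11)

Cell `pub-balaban-gaps` (G2), seat ne8, estimate **NE7c** (`T4IndicatorShell.ShellWeightBound`; two-run artefact, NOT PRINTED in
[Bałaban 1983–89], NOT PROVED).  Twenty-sixth proof-only file under `Spine/NE7c/`: seat ne6 GEN 13's census V25
`Spine/NE7b/CompactFibreCreationFloorSU2` (p381049 ✓) — the (n)-carrier's creation-step price in the `SU(2)` model BY VALUE but for the three
(A3) letters `λ, i₀` and the identification with Bałaban's step — consumed BY NAME at road (δ)'s live letters; imports that file and this seat's file 24 `LiveFactorWindowVolume`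
(for the one line of arithmetic `log_inv_mul_le`); nothing of Bałaban's is named; no `def`; 0 `sorry`.

THE QUESTION (seat census `HOME/ne/NE7c.md` §19, row 46 = rows 1 ∕ 44 ∕ 45 AT THE CREATION STEP).  ne6's price
`exp(i₀ − (λ∕2)δ′² + #bonds·(2 log η⁻¹ + log 16))·(∫F dκ)` has THREE window letters: the large-field radius `δ′` of the event «some bond at
quaternion distance `≥ δ′` from the centre» (the complement of the window `χ′` of [Balaban1989LargeFieldI] (1.82) — a large-field GAIN in an
exponent), the trace-window half-width `η` of the denominator's window (a VOLUME letter — a lower-bound use), and the excess `i₀` on the window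
(an upper use).  Road (δ) lowers the radius to `s·δ′`, `s ∈ [λ₀, 1]`, and the window to `W_{νη}`, `ν ∈ [ν₀, 1]` (`ν = s²`, `ν₀ = λ₀²` in the
quadratic dictionary; kept as separate letters).  Does the step still sell `e^{−P}`, with ONE price for the whole grid of assignments?

WHAT IS PROVED ([folklore]; ne6's theorems BY NAME at `(νη, sδ′)` plus two lines of real arithmetic):
* §1 `exponent_live_le` (with file 24's `log_inv_mul_le`) — the live exponent is below the ASSIGNMENT-FREE one:
  `i₀ − (λ∕2)(sδ′)² + n·(2 log (νη)⁻¹ + log 16) ≤ i₀ − λ₀²·(λ∕2)δ′² + n·(2 log η⁻¹ + log 16) + n·(2 log ν₀⁻¹)` (`λ ≥ 0`, `0 ≤ λ₀ ≤ s`,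
  `0 < ν₀ ≤ ν`, `η > 0`).
* §2 **`creationPrice_SU2_live`** — ne6's `creationPrice_SU2` with the event at radius `sδ′`, the window at `νη` (its `hGwin ∕ hIrel` read on
  the LIVE window) and the conclusion's constant replaced by `exp(i₀ − λ₀²·(λ∕2)δ′² + #bonds·(2 log η⁻¹ + log 16) + #bonds·(2 log ν₀⁻¹))` — the
  SAME for every assignment `(s, ν)` of the grid: radius LOSS × λ₀² in the exponent (census rows 1 ∕ 43 ∕ 45 pattern), volume LOSS additive
  `2 log ν₀⁻¹` per bond (row 44), `i₀` FREE (any bound valid on the live window; print's by monotonicity).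
* §3 **`creationPrice_factor_le_exp_neg_live`** — the LIVE LEDGER: with `∫F dκ ≤ 1` the live factor is `≤ e^{−P}` for EVERY assignment as soon as
  `P + i₀ + #bonds·(2 log η⁻¹ + log 16) + #bonds·(2 log ν₀⁻¹) ≤ λ₀²·(λ∕2)δ′²` — ne6's ledger inequality with `b_vol ↦ b_vol + 2 log ν₀⁻¹` per bond
  and the floor `× λ₀²`; **`eventually_ledger_row_live`** — and that row is STILL EVENTUALLY TRUE along print's flow: ne6's `eventually_ledger_row`
  at `c := λ₀²c`, `b := b + b₀` (model power `2`: the floor grows like `ℓ²`, the volume letter like `ℓ`; any `λ₀ > 0`).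
* §4 reading aid `ledger_live_iff_print_shifted` (the live ledger IS print's ledger for the shifted target `P + n·2 log ν₀⁻¹` and the scaled
  modulus `λ₀²λ`) and a decided toy.

CENSUS (row 46, NEW; `HOME/ne/NE7c.md` §19.2): at the creation step the three window letters of the (n)-carrier combine into ONE ledger row whose
live form differs from print's by `c ↦ λ₀²c` (the large-field exponent — class C1, the [Balaban1989LargeFieldII] p. 383 margin of census row 1,
here in the model's letters `(λ∕2)δ′² = ½γ₀W⁻¹A₁²p₁²`, `CompactFibreCreationFloor.print_floor_half`) and `b ↦ b + 2 log ν₀⁻¹` (the volume letter —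
row 44); print's margin is a POWER of `p₁(g_j)` against a logarithm, so the row stays eventually true for every `λ₀ > 0`: NO clause on `λ₀`,
one `g⋆(λ₀)` as in file 5's `roadDelta_clauses_of_g_small`.  Identical under (δ-1) and (δ-global…) (single-level letters).  BY-NAME EFFECT ON THE
WALL: none (junction ∕ census file).

NOT HERE (honest): `λ` (print's `γ₀W⁻¹`, `γ₀` = GAPS G-B9-09), `i₀`, `η(g_j)`, `δ′_j = g_jA₁p₁(g_j)` and that Bałaban's creation-step carrier IS
this one — ne6's (A3) ∕ (A1c) list applies verbatim; node O; NE7c.  VERDICT WORD UNCHANGED: WORK-bound behind node O; INSTANCE 0∕1.  NE7c ∕ NE7b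
NOT PRINTED ∕ NOT PROVED; spine 0∕9; one finite T⁴ — NOT ℝ⁴, NOT infinite volume, NOT the mass gap, NOT Clay.
HONEST DEPENDENCY (cell): continuum YM on T⁴ ⇐ BetaPertH ∧ nine spine estimates (0∕9 proved); BetaPertH ⇐ (D1) ∧ (D4) ∧ CAP+tail.
-/

set_option autoImplicit false

noncomputable section

open MeasureTheory Real Finset Filter
open Literature.MathematicalPhysics.QuantumFieldTheory (haarProbability)
open Literature.MathematicalPhysics.QuantumLattice (su2Quat)
open Summit.QuantumFields.BalabanUV.T4Continuum.NE7b.CompactFibreCreationFloorSU2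
open Summit.QuantumFields.BalabanUV.T4Continuum.Spine.NE7c.LiveFactorWindowVolume (log_inv_mul_le)

namespace Summit.QuantumFields.BalabanUV.T4Continuum.Spine.NE7c.LiveFactorCreationPrice

/-! ## §1 The live exponent is below the assignment-free one (file 24's `log_inv_mul_le` BY NAME) -/

/-- **THE LIVE EXPONENT ≤ THE ASSIGNMENT-FREE EXPONENT**: for `λ ≥ 0`, `0 ≤ λ₀ ≤ s`, `0 < ν₀ ≤ ν`, `η > 0`, `n ≥ 0`,
`i₀ − (λ∕2)(sδ′)² + n·(2 log (νη)⁻¹ + log 16) ≤ i₀ − λ₀²·((λ∕2)δ′²) + n·(2 log η⁻¹ + log 16) + n·(2 log ν₀⁻¹)`. [folklore] -/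
theorem exponent_live_le {i₀ lam δ' s lam0 ν ν₀ η n : ℝ} (hlam : 0 ≤ lam) (h0 : 0 ≤ lam0) (hs : lam0 ≤ s)
    (hν₀ : 0 < ν₀) (hν : ν₀ ≤ ν) (hη : 0 < η) (hn : 0 ≤ n) :
    i₀ - lam / 2 * (s * δ') ^ 2 + n * (2 * Real.log (ν * η)⁻¹ + Real.log 16) ≤
      i₀ - lam0 ^ 2 * (lam / 2 * δ' ^ 2) + n * (2 * Real.log η⁻¹ + Real.log 16) + n * (2 * Real.log ν₀⁻¹) := by
  have hsq : lam0 ^ 2 ≤ s ^ 2 := pow_le_pow_left₀ h0 hs 2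
  have hfloor : lam0 ^ 2 * (lam / 2 * δ' ^ 2) ≤ lam / 2 * (s * δ') ^ 2 := by
    have hnn : 0 ≤ lam / 2 * δ' ^ 2 := by positivity
    calc lam0 ^ 2 * (lam / 2 * δ' ^ 2) ≤ s ^ 2 * (lam / 2 * δ' ^ 2) := mul_le_mul_of_nonneg_right hsq hnn
      _ = lam / 2 * (s * δ') ^ 2 := by ring
  have hlog : n * (2 * Real.log (ν * η)⁻¹ + Real.log 16) ≤ n * (2 * Real.log η⁻¹ + Real.log 16) + n * (2 * Real.log ν₀⁻¹) := by
    have h1 : 2 * Real.log (ν * η)⁻¹ + Real.log 16 ≤ (2 * Real.log η⁻¹ + Real.log 16) + 2 * Real.log ν₀⁻¹ := by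
      linarith [log_inv_mul_le hν₀ hν hη]
    have := mul_le_mul_of_nonneg_left h1 hn
    linarith
  linarith

/-! ## §2 ne6's creation-step price at live letters: ONE price for the grid -/

section SU2

variable {B : Type*} [Fintype B] {Y : Type*} [MeasurableSpace Y] (μ : Measure Y) [SFinite μ]

/-- **THE (n)-CARRIER'S CREATION-STEP PRICE AT LIVE LETTERS, ASSIGNMENT-FREE** (`SU(2)` model).  ne6's `creationPrice_SU2` with the
large-field event at the LIVE radius `s·δ′` (`0 ≤ λ₀ ≤ s`), the denominator's window at the LIVE half-width `νη` (`0 < η ≤ ¼`, `0 < ν₀ ≤ ν ≤ 1`;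
`hGwin ∕ hIrel` read on the live window), all other hypotheses verbatim; then
`∫ F·w·e^{−I} ≤ exp(i₀ − λ₀²·(λ∕2)δ′² + #bonds·(2 log η⁻¹ + log 16) + #bonds·(2 log ν₀⁻¹))·(∫F dκ)·∫ G·w·e^{−I}` — the SAME constant for every
assignment `(s, ν)`. [folklore] -/
theorem creationPrice_SU2_live {η ν ν₀ s lam0 : ℝ} (hη0 : 0 < η) (hη : η ≤ 1 / 4) (hν₀ : 0 < ν₀) (hν : ν₀ ≤ ν) (hν1 : ν ≤ 1)
    (h0 : 0 ≤ lam0) (hs : lam0 ≤ s)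
    (F G : (B → Matrix.specialUnitaryGroup (Fin 2) ℂ) → ℝ) (w : Y → ℝ)
    (I : (B → Matrix.specialUnitaryGroup (Fin 2) ℂ) × Y → ℝ) (m₀ : Y → ℝ) (U₀ : Y → (B → Matrix.specialUnitaryGroup (Fin 2) ℂ))
    {i₀ lam δ' : ℝ} (hF0 : ∀ x, 0 ≤ F x) (hG0 : ∀ x, 0 ≤ G x) (hw0 : ∀ y, 0 ≤ w y) (hlam : 0 ≤ lam) (hδ : 0 ≤ δ')
    (hF : ∀ x y, F x ≠ 0 → w y ≠ 0 → ∃ b : B, s * δ' ≤ ‖su2Quat ((U₀ y b)⁻¹ * x b) - 1‖)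
    (hconv : ∀ x y, F x ≠ 0 → w y ≠ 0 → m₀ y + lam / 2 * ∑ b, ‖su2Quat ((U₀ y b)⁻¹ * x b) - 1‖ ^ 2 ≤ I (x, y))
    (hGwin : ∀ y v, w y ≠ 0 →
      v ∈ (Set.univ.pi fun _ : B => {U : Matrix.specialUnitaryGroup (Fin 2) ℂ | 2 - ((U : Matrix (Fin 2) (Fin 2) ℂ).trace).re ≤ ν * η}) →
      1 ≤ G (U₀ y * v))
    (hIrel : ∀ y v, w y ≠ 0 →
      v ∈ (Set.univ.pi fun _ : B => {U : Matrix.specialUnitaryGroup (Fin 2) ℂ | 2 - ((U : Matrix (Fin 2) (Fin 2) ℂ).trace).re ≤ ν * η}) →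
      I (U₀ y * v, y) ≤ m₀ y + i₀)
    (hFi : Integrable F (Measure.pi fun _ : B => haarProbability (Matrix.specialUnitaryGroup (Fin 2) ℂ)))
    (hGI : ∀ y, w y ≠ 0 →
      Integrable (fun x => G x * exp (-I (x, y))) (Measure.pi fun _ : B => haarProbability (Matrix.specialUnitaryGroup (Fin 2) ℂ)))
    (hA' : Integrable (fun z : (B → Matrix.specialUnitaryGroup (Fin 2) ℂ) × Y => F z.1 * w z.2 * exp (-I z))
      ((Measure.pi fun _ : B => haarProbability (Matrix.specialUnitaryGroup (Fin 2) ℂ)).prod μ))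
    (hB' : Integrable (fun z : (B → Matrix.specialUnitaryGroup (Fin 2) ℂ) × Y => G z.1 * w z.2 * exp (-I z))
      ((Measure.pi fun _ : B => haarProbability (Matrix.specialUnitaryGroup (Fin 2) ℂ)).prod μ)) :
    ∫ z, F z.1 * w z.2 * exp (-I z) ∂((Measure.pi fun _ : B => haarProbability (Matrix.specialUnitaryGroup (Fin 2) ℂ)).prod μ) ≤
      exp (i₀ - lam0 ^ 2 * (lam / 2 * δ' ^ 2) + (Fintype.card B : ℝ) * (2 * Real.log η⁻¹ + Real.log 16)
            + (Fintype.card B : ℝ) * (2 * Real.log ν₀⁻¹)) *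
        (∫ x, F x ∂(Measure.pi fun _ : B => haarProbability (Matrix.specialUnitaryGroup (Fin 2) ℂ))) *
        ∫ z, G z.1 * w z.2 * exp (-I z) ∂((Measure.pi fun _ : B => haarProbability (Matrix.specialUnitaryGroup (Fin 2) ℂ)).prod μ) := by
  have hνpos : 0 < ν := hν₀.trans_le hν
  have hνη0 : 0 < ν * η := mul_pos hνpos hη0
  have hνη : ν * η ≤ 1 / 4 := (mul_le_of_le_one_left hη0.le hν1).trans hη
  have hsδ : 0 ≤ s * δ' := mul_nonneg (h0.trans hs) hδ
  -- ne6's price at the live letters `(νη, sδ′)`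
  have key := creationPrice_SU2 μ hνη0 hνη F G w I m₀ U₀ hF0 hG0 hw0 hlam hsδ hF hconv hGwin hIrel hFi hGI hA' hB'
  -- the two nonnegative factors
  have hFint : 0 ≤ ∫ x, F x ∂(Measure.pi fun _ : B => haarProbability (Matrix.specialUnitaryGroup (Fin 2) ℂ)) :=
    integral_nonneg hF0
  have hint : 0 ≤ ∫ z, G z.1 * w z.2 * exp (-I z)
      ∂((Measure.pi fun _ : B => haarProbability (Matrix.specialUnitaryGroup (Fin 2) ℂ)).prod μ) :=
    integral_nonneg fun z => mul_nonneg (mul_nonneg (hG0 _) (hw0 _)) (exp_pos _).le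
  -- exponent comparison
  have hexp := Real.exp_le_exp.2
    (exponent_live_le (i₀ := i₀) (δ' := δ') hlam h0 hs hν₀ hν hη0 (Nat.cast_nonneg (Fintype.card B)))
  refine key.trans ?_
  have := mul_le_mul_of_nonneg_right (mul_le_mul_of_nonneg_right hexp hFint) hint
  simpa [mul_assoc] using this

end SU2

/-! ## §3 The live ledger: when does the step STILL sell `e^{−P}`? -/

/-- **THE LIVE LEDGER** (`SU(2)` model): with `∫F dκ ≤ 1` the live factor of every assignment (`s ≥ λ₀ ≥ 0`, `ν ∈ [ν₀, 1]`, `η > 0`, `λ ≥ 0`)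
is `≤ e^{−P}` as soon as the ASSIGNMENT-FREE ledger inequality
`P + i₀ + #bonds·(2 log η⁻¹ + log 16) + #bonds·(2 log ν₀⁻¹) ≤ λ₀²·(λ∕2)δ′²` holds — ne6's `creationPrice_SU2_factor_le_exp_neg` with the volume
letter shifted by `2 log ν₀⁻¹` per bond and the floor scaled by `λ₀²`. [folklore] -/
theorem creationPrice_factor_le_exp_neg_live {η ν ν₀ s lam0 i₀ lam δ' A P : ℝ} {n : ℕ} (hA1 : A ≤ 1)
    (hlam : 0 ≤ lam) (h0 : 0 ≤ lam0) (hs : lam0 ≤ s) (hν₀ : 0 < ν₀) (hν : ν₀ ≤ ν) (hη : 0 < η)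
    (hledger : P + i₀ + (n : ℝ) * (2 * Real.log η⁻¹ + Real.log 16) + (n : ℝ) * (2 * Real.log ν₀⁻¹) ≤
      lam0 ^ 2 * (lam / 2 * δ' ^ 2)) :
    exp (i₀ - lam / 2 * (s * δ') ^ 2 + (n : ℝ) * (2 * Real.log (ν * η)⁻¹ + Real.log 16)) * A ≤ exp (-P) := by
  have hle := exponent_live_le (i₀ := i₀) (δ' := δ') hlam h0 hs hν₀ hν hη (Nat.cast_nonneg n)
  calc exp (i₀ - lam / 2 * (s * δ') ^ 2 + (n : ℝ) * (2 * Real.log (ν * η)⁻¹ + Real.log 16)) * A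
      ≤ exp (i₀ - lam / 2 * (s * δ') ^ 2 + (n : ℝ) * (2 * Real.log (ν * η)⁻¹ + Real.log 16)) * 1 :=
        mul_le_mul_of_nonneg_left hA1 (exp_pos _).le
    _ ≤ exp (-P) := by rw [mul_one]; exact Real.exp_le_exp.2 (by linarith)

/-- **THE LIVE LEDGER ROW IS STILL EVENTUALLY TRUE** (model power `2` for `p₁(g)² ∕ ℓ`, as ne6's `eventually_ledger_row`): for `c > 0`,
`λ₀ > 0` and any `P, i₀, n, b, b₀`: `P + i₀ + n·(ℓ + (b + b₀)) ≤ (λ₀²c)·ℓ²` for all large `ℓ` — the floor `c ↦ λ₀²c`, the volume letter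
`b ↦ b + b₀` (`b₀ = 2 log ν₀⁻¹`): a POWER against a logarithm, so NO clause on `λ₀`. [folklore] -/
theorem eventually_ledger_row_live {c P i₀ n b b₀ lam0 : ℝ} (hc : 0 < c) (h0 : 0 < lam0) :
    ∀ᶠ ℓ : ℝ in atTop, P + i₀ + n * (ℓ + (b + b₀)) ≤ (lam0 ^ 2 * c) * ℓ ^ 2 :=
  eventually_ledger_row (P := P) (i₀ := i₀) (n := n) (b := b + b₀) (by positivity)

/-! ## §4 Reading aid and sanity -/

/-- The live ledger IS print's ledger for the SHIFTED target `P + n·(2 log ν₀⁻¹)` and the SCALED modulus `λ₀²·λ` (pure rewriting). [folklore] -/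
theorem ledger_live_iff_print_shifted {P i₀ n η ν₀ lam lam0 δ' : ℝ} :
    P + i₀ + n * (2 * Real.log η⁻¹ + Real.log 16) + n * (2 * Real.log ν₀⁻¹) ≤ lam0 ^ 2 * (lam / 2 * δ' ^ 2) ↔
      (P + n * (2 * Real.log ν₀⁻¹)) + i₀ + n * (2 * Real.log η⁻¹ + Real.log 16) ≤ (lam0 ^ 2 * lam) / 2 * δ' ^ 2 := by
  constructor <;> intro h <;> linarith

/-- Decided toy for §3's arithmetic: `P = 1`, `i₀ = 1`, no bonds, `λ₀ = ½`, `λ = 16`, `δ′ = 1`: the live floor `λ₀²·(λ∕2)δ′² = 2 = P + i₀`,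
so the step sells exactly `e^{−1}` at EVERY assignment — here checked at `s = ½`, `ν = ν₀ = η = 1`. -/
example : exp ((1 : ℝ) - 16 / 2 * ((1 / 2 : ℝ) * 1) ^ 2 + ((0 : ℕ) : ℝ) * (2 * Real.log ((1 : ℝ) * 1)⁻¹ + Real.log 16)) * (1 : ℝ) ≤
    exp (-(1 : ℝ)) :=
  creationPrice_factor_le_exp_neg_live (lam0 := 1 / 2) (ν₀ := 1) le_rfl (by norm_num) (by norm_num) le_rfl one_pos le_rfl one_pos
    (by push_cast; norm_num)

end Summit.QuantumFields.BalabanUV.T4Continuum.Spine.NE7c.LiveFactorCreationPrice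

end
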